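import Mathlib.Analysis.SpecialFunctions.Integrability.Basic
import Literature.NumberTheory.Transcendental.KZSemiCanonicalReductionProofs
import Literature.NumberTheory.Transcendental.SemialgebraicMonotonicityDefinable
import HarnessLib

/-!
# Viu-Sos' semi-canonical reduction in dimension one: no poles to separate

[Viu-Sos 2021, §2.3, first paragraph]: "It is easy to check that, for absolutely convergent
integrals `I(S, P/Q)` with semi-algebraic domains defined in `ℝ`, the change of variables over the
projective line removes automatically the pole of order 2 which appears in the boundary (see
Example 5.1)" — in dimension `1` the separation of poles (step (b) of the proof of Thm. 1.1,
Prop. 2.2 / Cor. 2.2, which in general needs Hironaka's embedded resolution) is automatic. This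
file proves the underlying elementary fact in the form consumed by
`KZ.exists_isCompact_of_value_pos` of `KZSemiCanonicalReductionProofs.lean`:

* `KZ.exists_bound_of_isRational_one` — a rational function `p/q` with rational coefficients,
  `q ≠ 0` on a bounded `ℚ`-semialgebraic `σ ⊆ ℝ¹` and `p/q ∈ L¹(σ)`, is BOUNDED on `σ`. Indeed near a
  point `a` of the closure of `σ` with `q(a) = 0`, either `σ` contains no points close to `a`
  (o-minimality of the line: one-sided germs of `σ` at `a` are constant,
  `SemialgebraicMonotonicity.eventually_nhdsGT_mem_or`), or it contains a one-sided interval at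
  `a`, on which `|p/q| ≍ |t − a|^{l − m}` (`l`, `m` the root multiplicities of `p`, `q` at `a`) is
  integrable only if `l ≥ m`, i.e. only if `p/q` extends continuously to `a`; compactness of the
  closure of `σ` concludes;
* `KZ.boundedReduction_one` — hence hypothesis `H` of
  `KZ.semiCanonicalReduction_of_boundedReduction` holds in dimension `1` (with the representation
  itself as the single piece);
* `KZ.semiCanonicalReduction_one` — Thm. 1.1 for `d = 1`, unconditionally: a non-zero period
  `∫_σ p/q dx` (`σ ⊆ ℝ`) is `± vol₂(K)`, `K ⊆ ℝ²` compact with non-empty interior, by the moves;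
* `KZ.semiCanonicalReduction_of_boundedReduction_two_le` — the fact from the bounded reduction
  in dimensions `n ≥ 2` only (dimensions `0` and `1` being settled here).

## References

* J. Viu-Sos, *A semi-canonical reduction for periods of Kontsevich–Zagier*, Int. J. Number
  Theory 17 (2021) 147–174 (arXiv:1509.01097), §2.3 (first paragraph), Example 5.1.
* L. van den Dries, *Tame topology and o-minimal structures*, CUP 1998, Ch. 1 (3.3)(ii)
  (one-sided germs of definable subsets of the line).
-/

noncomputable section

open MeasureTheory Set Filter Topology
open scoped Polynomial
open Literature.ModelTheory.ExponentialFields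

namespace Literature.NumberTheory.Transcendental

namespace KZ

/-! ### Univariate reading of `MvPolynomial (Fin 1) ℚ` -/

/-- The real univariate polynomial attached to `p ∈ ℚ[X₀]`. [folklore] -/
theorem exists_polynomial_eval_eq (p : MvPolynomial (Fin 1) ℚ) :
    ∃ P : ℝ[X], ∀ t : ℝ, MvPolynomial.aeval (fun _ : Fin 1 => t) p = P.eval t := by
  refine ⟨(MvPolynomial.aeval (fun _ : Fin 1 => (Polynomial.X : ℚ[X])) p).map (algebraMap ℚ ℝ),
    fun t => ?_⟩
  rw [Polynomial.eval_map, ← Polynomial.aeval_def, ← AlgHom.comp_apply, MvPolynomial.comp_aeval]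
  simp

/-- A point of `ℝ¹` is the constant function with its value at `0`. [folklore] -/
theorem eq_const_apply_zero (x : Fin 1 → ℝ) : x = fun _ => x 0 := by
  funext i
  rw [Subsingleton.elim i 0]

/-! ### Local analysis of `p/q` at a zero of `q` -/

/-- **No integrable pole in one variable.** Let `P, Q ∈ ℝ[X]`, `Q ≠ 0`, `a ∈ [u, v]` with `u < v`,
and suppose `P/Q` is integrable on `(u, v)`. Then the root multiplicity of `Q` at `a` is at most
that of `P` (if `P ≠ 0`): otherwise `|P/Q| ≥ c |t − a|⁻¹` near `a`, which is not integrable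
(`intervalIntegrable_sub_inv_iff`). [Viu-Sos 2021, §2.3 (first paragraph)]
[cite: ViuSos2021, §2.3] -/
theorem rootMultiplicity_le_of_integrableOn {P Q : ℝ[X]} (hP : P ≠ 0) (hQ : Q ≠ 0) {u v a : ℝ}
    (huv : u < v) (ha : a ∈ Icc u v)
    (hint : IntegrableOn (fun t => P.eval t / Q.eval t) (Ioo u v)) :
    Q.rootMultiplicity a ≤ P.rootMultiplicity a := by
  by_contra hlt
  rw [not_le] at hlt
  set l := P.rootMultiplicity a with hl
  set m := Q.rootMultiplicity a with hm
  obtain ⟨P₁, hP₁, hP₁a⟩ := P.exists_eq_pow_rootMultiplicity_mul_and_not_dvd hP a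
  obtain ⟨Q₁, hQ₁, hQ₁a⟩ := Q.exists_eq_pow_rootMultiplicity_mul_and_not_dvd hQ a
  rw [Polynomial.dvd_iff_isRoot, Polynomial.IsRoot.def] at hP₁a hQ₁a
  -- the unit `P₁/Q₁` is bounded below near `a`
  have hu : ContinuousAt (fun t => P₁.eval t / Q₁.eval t) a :=
    (P₁.continuous.continuousAt).div Q₁.continuous.continuousAt hQ₁a
  have hua : P₁.eval a / Q₁.eval a ≠ 0 := div_ne_zero hP₁a hQ₁a
  set c₀ := |P₁.eval a / Q₁.eval a| / 2 with hc₀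
  have hc₀pos : 0 < c₀ := by positivity
  obtain ⟨δ, hδ, hδc⟩ : ∃ δ > 0, ∀ t, |t - a| < δ → c₀ ≤ |P₁.eval t / Q₁.eval t| := by
    have h := Metric.continuousAt_iff.mp hu c₀ hc₀pos
    obtain ⟨δ, hδ, h⟩ := h
    refine ⟨δ, hδ, fun t ht => ?_⟩
    have := h (by rwa [Real.dist_eq])
    rw [Real.dist_eq] at this
    have htri := abs_sub_abs_le_abs_sub (P₁.eval a / Q₁.eval a) (P₁.eval t / Q₁.eval t)
    rw [abs_sub_comm] at htri
    rw [hc₀] at this ⊢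
    linarith
  -- shrink the interval around `a`
  set u' := max u (a - min δ 1) with hu'
  set v' := min v (a + min δ 1) with hv'
  have hδ1 : 0 < min δ 1 := lt_min hδ one_pos
  have hu'v' : u' < v' := by
    simp only [hu', hv', max_lt_iff, lt_min_iff]
    refine ⟨⟨huv, ?_⟩, ?_, ?_⟩ <;> linarith [ha.1, ha.2]
  have hsub : Ioo u' v' ⊆ Ioo u v := Ioo_subset_Ioo (le_max_left _ _) (min_le_left _ _)
  have ha' : a ∈ uIcc u' v' := by
    rw [uIcc_of_le hu'v'.le]
    exact ⟨max_le ha.1 (by linarith), le_min ha.2 (by linarith)⟩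
  have hnear : ∀ t ∈ Ioo u' v', |t - a| < min δ 1 := fun t ht => by
    rw [abs_lt]
    simp only [hu', hv', mem_Ioo, max_lt_iff, lt_min_iff] at ht
    constructor <;> linarith [ht.1.2, ht.2.2]
  -- the lower bound `c₀ |t - a|⁻¹ ≤ |P/Q|` off `a`
  have hfac : ∀ t, t ≠ a → P.eval t / Q.eval t =
      (P₁.eval t / Q₁.eval t) * ((t - a) ^ (m - l))⁻¹ := by
    intro t hta
    have hta' : t - a ≠ 0 := sub_ne_zero.mpr hta
    have hml : m = l + (m - l) := (Nat.add_sub_cancel' hlt.le).symm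
    conv_lhs => rw [hP₁, hQ₁]
    simp only [Polynomial.eval_mul, Polynomial.eval_pow, Polynomial.eval_sub, Polynomial.eval_X,
      Polynomial.eval_C]
    rw [← hl, ← hm, hml, pow_add, Nat.add_sub_cancel_left]
    have hQ₁t : (t - a) ^ l ≠ 0 := pow_ne_zero _ hta'
    field_simp
  have hbound : ∀ t ∈ Ioo u' v', t ≠ a → c₀ * |(t - a)⁻¹| ≤ |P.eval t / Q.eval t| := by
    intro t ht hta
    have h1 := hnear t ht
    have hta' : 0 < |t - a| := abs_pos.mpr (sub_ne_zero.mpr hta)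
    rw [hfac t hta, abs_mul, abs_inv, abs_inv, abs_pow]
    have h2 : |t - a| ^ (m - l) ≤ |t - a| := by
      calc |t - a| ^ (m - l) ≤ |t - a| ^ 1 :=
            pow_le_pow_of_le_one hta'.le (h1.le.trans (min_le_right _ _)) (Nat.one_le_iff_ne_zero.mpr
              (Nat.sub_ne_zero_of_lt hlt))
        _ = |t - a| := pow_one _
    have h3 : |t - a|⁻¹ ≤ (|t - a| ^ (m - l))⁻¹ := by
      rw [inv_le_inv₀ hta' (pow_pos hta' _)]
      exact h2
    calc c₀ * |t - a|⁻¹ ≤ c₀ * (|t - a| ^ (m - l))⁻¹ := mul_le_mul_of_nonneg_left h3 hc₀pos.le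
      _ ≤ |P₁.eval t / Q₁.eval t| * (|t - a| ^ (m - l))⁻¹ :=
          mul_le_mul_of_nonneg_right (hδc t (h1.trans_le (min_le_left _ _))) (by positivity)
  -- `(t - a)⁻¹` would be integrable on `(u', v')`
  have hint' : IntegrableOn (fun t => (t - a)⁻¹) (Ioo u' v') := by
    have hg : IntegrableOn (fun t => c₀⁻¹ * ‖P.eval t / Q.eval t‖) (Ioo u' v') :=
      (hint.mono_set hsub).norm.const_mul _
    refine hg.mono' ((measurable_id.sub_const a).inv.aestronglyMeasurable) ?_
    rw [ae_restrict_iff' measurableSet_Ioo]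
    refine (ae_iff.mpr ?_).mono fun t (hta : t ≠ a) ht => ?_
    · simp only [not_not, setOf_eq_eq_singleton, Real.volume_singleton]
    · rw [Real.norm_eq_abs, Real.norm_eq_abs, ← div_eq_inv_mul, le_div_iff₀ hc₀pos, mul_comm]
      exact hbound t ht hta
  have := (intervalIntegrable_iff_integrableOn_Ioo_of_le hu'v'.le).mpr hint'
  rw [intervalIntegrable_sub_inv_iff] at this
  rcases this with h | h
  · exact hu'v'.ne h
  · exact h ha'

/-- **Continuous extension across a non-pole.** If the root multiplicity of `Q ≠ 0` at `a` is at
most that of `P ≠ 0`, then `P/Q` is bounded near `a` off `a`. [folklore] -/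
theorem exists_bound_nhds_of_rootMultiplicity_le {P Q : ℝ[X]} (hP : P ≠ 0) (hQ : Q ≠ 0) {a : ℝ}
    (hle : Q.rootMultiplicity a ≤ P.rootMultiplicity a) :
    ∃ U ∈ 𝓝 a, ∃ M : ℝ, ∀ t ∈ U, t ≠ a → |P.eval t / Q.eval t| ≤ M := by
  set l := P.rootMultiplicity a with hl
  set m := Q.rootMultiplicity a with hm
  obtain ⟨P₁, hP₁, -⟩ := P.exists_eq_pow_rootMultiplicity_mul_and_not_dvd hP a
  obtain ⟨Q₁, hQ₁, hQ₁a⟩ := Q.exists_eq_pow_rootMultiplicity_mul_and_not_dvd hQ a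
  rw [Polynomial.dvd_iff_isRoot, Polynomial.IsRoot.def] at hQ₁a
  -- `P/Q = (t - a)^(l - m) P₁/Q₁` off `a`, and the right-hand side is continuous at `a`
  set g : ℝ → ℝ := fun t => (t - a) ^ (l - m) * (P₁.eval t / Q₁.eval t) with hg
  have hgc : ContinuousAt g a :=
    ((continuous_id.sub continuous_const).pow _).continuousAt.mul
      ((P₁.continuous.continuousAt).div Q₁.continuous.continuousAt hQ₁a)
  have hfac : ∀ t, t ≠ a → P.eval t / Q.eval t = g t := by
    intro t hta
    have hta' : t - a ≠ 0 := sub_ne_zero.mpr hta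
    have hlm : l = m + (l - m) := (Nat.add_sub_cancel' hle).symm
    conv_lhs => rw [hP₁, hQ₁]
    simp only [Polynomial.eval_mul, Polynomial.eval_pow, Polynomial.eval_sub, Polynomial.eval_X,
      Polynomial.eval_C, hg]
    rw [← hl, ← hm, hlm, pow_add, Nat.add_sub_cancel_left]
    have : (t - a) ^ m ≠ 0 := pow_ne_zero _ hta'
    by_cases hQ₁t : Q₁.eval t = 0
    · simp [hQ₁t]
    · field_simp
  obtain ⟨δ, hδ, hδg⟩ := Metric.continuousAt_iff.mp hgc 1 one_pos
  refine ⟨Metric.ball a δ, Metric.ball_mem_nhds a hδ, |g a| + 1, fun t ht hta => ?_⟩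
  rw [hfac t hta]
  have := hδg ht
  rw [Real.dist_eq] at this
  linarith [abs_sub_abs_le_abs_sub (g t) (g a)]


/-! ### Boundedness of integrable rational functions of one variable -/

open SemialgebraicMonotonicity in
/-- **An integrable rational function of one variable on a bounded `ℚ`-semialgebraic set is
bounded** (Viu-Sos 2021, §2.3, first paragraph: in dimension one no pole has to be separated).
For `r = (σ, p/q)` with `σ ⊆ ℝ¹` bounded, `q ≠ 0` on `σ` and `p/q ∈ L¹(σ)`: near a point `a` with
`q(a) = 0`, by o-minimality of the line either `σ` avoids a punctured neighbourhood of `a`, or it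
contains a one-sided interval at `a`, where integrability forces the order of `p/q` at `a` to be
`≥ 0` (`rootMultiplicity_le_of_integrableOn`), so `p/q` is bounded near `a`
(`exists_bound_nhds_of_rootMultiplicity_le`); a finite subcover of the compact closure of `σ`
gives the bound. [cite: ViuSos2021, §2.3] -/
theorem exists_bound_of_isRational_one (r : IntegralRep 1) (hr : r.IsRational)
    (hb : Bornology.IsBounded r.domain) : ∃ M : ℝ, ∀ x ∈ r.domain, |r.integrand x| ≤ M := by
  classical
  obtain ⟨p, q, hq, hpq⟩ := hr
  obtain ⟨P, hP⟩ := exists_polynomial_eval_eq p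
  obtain ⟨Q, hQ⟩ := exists_polynomial_eval_eq q
  -- the reading on the real line
  set e : ℝ → (Fin 1 → ℝ) := fun t _ => t with he
  set A : Set ℝ := e ⁻¹' r.domain with hA
  have hxe : ∀ x : Fin 1 → ℝ, x = e (x 0) := eq_const_apply_zero
  have hf : ∀ t ∈ A, r.integrand (e t) = P.eval t / Q.eval t := fun t ht => by
    rw [hpq ht]
    exact congrArg₂ (· / ·) (hP t) (hQ t)
  have hQA : ∀ t ∈ A, Q.eval t ≠ 0 := fun t ht => by
    rw [← hQ]
    exact hq _ ht
  -- degenerate cases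
  by_cases hP0 : P = 0
  · refine ⟨0, fun x hx => ?_⟩
    rw [hxe x] at hx ⊢
    rw [hf _ hx, hP0, Polynomial.eval_zero, zero_div, abs_zero]
  by_cases hA0 : A = ∅
  · refine ⟨0, fun x hx => ?_⟩
    rw [hxe x] at hx
    exact ((Set.eq_empty_iff_forall_notMem.mp hA0) (x 0) hx).elim
  have hQ0 : Q ≠ 0 := by
    obtain ⟨t, ht⟩ := nonempty_iff_ne_empty.mpr hA0
    intro h
    exact hQA t ht (by rw [h, Polynomial.eval_zero])
  -- integrability on the line
  have hint : IntegrableOn (fun t => P.eval t / Q.eval t) A := by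
    set Φ := MeasurableEquiv.funUnique (Fin 1) ℝ with hΦ
    have hΦe : ⇑Φ.symm = e := by
      funext t i
      rw [hΦ, MeasurableEquiv.funUnique_symm_apply]
      exact uniqueElim_const t i
    have h := ((volume_preserving_funUnique (Fin 1) ℝ).symm Φ).integrableOn_comp_preimage
      Φ.symm.measurableEmbedding (f := r.integrand) (s := r.domain)
    rw [hΦe] at h
    have hAm : MeasurableSet A := (continuous_pi fun _ => continuous_id).measurable
      (IntegralRep.measurableSet_domain_holds r)
    exact (h.mpr r.integrableOn).congr_fun (fun t ht => hf t ht) hAm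
  -- `A` is real-semialgebraic on the line
  have hsa : IsSemialgebraic ℝ {z : Fin 1 → ℝ | z 0 ∈ A} := by
    have : {z : Fin 1 → ℝ | z 0 ∈ A} = r.domain := by
      ext z
      rw [mem_setOf_eq, hA, mem_preimage, ← hxe z]
    rw [this]
    exact isSemialgebraic_real_of r.isSemialgebraic_domain
  -- local boundedness at every point of the line
  have hloc : ∀ a : ℝ, ∃ U ∈ 𝓝 a, ∃ M : ℝ, ∀ t ∈ U, t ∈ A → |P.eval t / Q.eval t| ≤ M := by
    intro a
    by_cases hQa : Q.eval a = 0
    · have haA : a ∉ A := fun h => hQA a h hQa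
      -- an adjacent interval in `A` forces a non-pole at `a`
      have key : ∀ {u v : ℝ}, u < v → a ∈ Icc u v → Ioo u v ⊆ A →
          ∃ U ∈ 𝓝 a, ∃ M : ℝ, ∀ t ∈ U, t ∈ A → |P.eval t / Q.eval t| ≤ M := by
        intro u v huv ha hsub
        have hle := rootMultiplicity_le_of_integrableOn hP0 hQ0 huv ha (hint.mono_set hsub)
        obtain ⟨U, hU, M, hM⟩ := exists_bound_nhds_of_rootMultiplicity_le hP0 hQ0 hle
        exact ⟨U, hU, M, fun t ht htA => hM t ht fun h => haA (h ▸ htA)⟩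
      rcases eventually_nhdsGT_mem_or hsa a with hR | hR
      · obtain ⟨c, hc, hsub⟩ := mem_nhdsGT_iff_exists_Ioo_subset.mp hR
        exact key hc ⟨le_rfl, le_of_lt hc⟩ hsub
      rcases eventually_nhdsLT_mem_or hsa a with hL | hL
      · obtain ⟨c, hc, hsub⟩ := mem_nhdsLT_iff_exists_Ioo_subset.mp hL
        exact key hc ⟨le_of_lt hc, le_rfl⟩ hsub
      -- both one-sided germs of `A` at `a` are empty
      have hev : ∀ᶠ y in 𝓝 a, y ∈ A → |P.eval y / Q.eval y| ≤ 0 := by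
        rw [← nhdsNE_sup_pure, ← nhdsLT_sup_nhdsGT, eventually_sup, eventually_sup,
          eventually_pure]
        exact ⟨⟨hL.mono fun y hy hyA => (hy hyA).elim, hR.mono fun y hy hyA => (hy hyA).elim⟩,
          fun h => (haA h).elim⟩
      obtain ⟨U, hU, hUM⟩ := hev.exists_mem
      exact ⟨U, hU, 0, hUM⟩
    · -- `Q a ≠ 0`: continuity at `a`
      have hc : ContinuousAt (fun t => P.eval t / Q.eval t) a :=
        (P.continuous.continuousAt).div Q.continuous.continuousAt hQa
      obtain ⟨δ, hδ, hδg⟩ := Metric.continuousAt_iff.mp hc 1 one_pos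
      refine ⟨Metric.ball a δ, Metric.ball_mem_nhds a hδ, |P.eval a / Q.eval a| + 1,
        fun t ht _ => ?_⟩
      have := hδg ht
      rw [Real.dist_eq] at this
      linarith [abs_sub_abs_le_abs_sub (P.eval t / Q.eval t) (P.eval a / Q.eval a)]
  -- compactness of the closure of `A`
  obtain ⟨C, hC⟩ := isBounded_iff_forall_norm_le.mp hb
  have hAb : Bornology.IsBounded A := by
    refine (Metric.isBounded_Icc (-C) C).subset fun t ht => ?_
    have h := (norm_le_pi_norm (e t) 0).trans (hC _ ht)
    rw [Real.norm_eq_abs, abs_le] at h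
    exact h
  choose U hU M hM using hloc
  obtain ⟨tf, -, hcover⟩ := hAb.isCompact_closure.elim_nhds_subcover U fun a _ => hU a
  refine ⟨∑ a ∈ tf, |M a|, fun x hx => ?_⟩
  rw [hxe x] at hx ⊢
  rw [hf _ hx]
  obtain ⟨a, ha, hta⟩ := mem_iUnion₂.mp (hcover (subset_closure hx))
  exact ((hM a _ hta hx).trans (le_abs_self _)).trans
    (Finset.single_le_sum (fun i _ => abs_nonneg (M i)) ha)

/-- **The bounded reduction (hypothesis `H` of `KZ.semiCanonicalReduction_of_boundedReduction`)
holds in dimension `1`**, with the representation itself as the only piece: there are no poles to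
separate. [Viu-Sos 2021, §2.3 (first paragraph), Example 5.1] [cite: ViuSos2021, §2.3] -/
theorem boundedReduction_one (r : IntegralRep 1) (hr : r.IsRational)
    (hb : Bornology.IsBounded r.domain) :
    ∃ (k : ℕ) (R : Fin k → IntegralRep 1), (∀ j, Bornology.IsBounded (R j).domain ∧
      ∃ M : ℝ, ∀ x ∈ (R j).domain, |(R j).integrand x| ≤ M) ∧ of r - ∑ j, of (R j) ∈ relations :=
  ⟨1, fun _ => r, fun _ => ⟨hb, exists_bound_of_isRational_one r hr hb⟩, by
    simp [relations.zero_mem]⟩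


/-- **Thm. 1.1 in dimension one, unconditionally** [Viu-Sos 2021, Thm. 1.1 with §2.3 (first
paragraph) and Example 5.1]: a non-zero real period given by a one-variable rational integral
`∫_σ p/q`, `σ ⊆ ℝ` `ℚ`-semialgebraic, is `sgn · vol₂(K)` for a compact `ℚ`-semialgebraic `K ⊆ ℝ²`
with non-empty interior, by the moves of the calculus (`exists_isCompact_of_value_pos` fed with
`boundedReduction_one`; e.g. `π = ∫ dx/(1+x²)` becomes the area of `{-1 ≤ x ≤ 1, -1 ≤ z(1+x²) ≤ 1}`
in Example 5.1). [cite: ViuSos2021, Thm. 1.1 (d = 1) and Example 5.1] -/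
theorem semiCanonicalReduction_one (r : IntegralRep 1) (hr : r.IsRational) (hne : r.value ≠ 0) :
    ∃ K : IntegralRep 2, IsCompact K.domain ∧ (interior K.domain).Nonempty ∧
      (∀ z ∈ K.domain, K.integrand z = 1) ∧ (0 < r.value → of r - of K ∈ relations) ∧
      (r.value < 0 → of r + of K ∈ relations) := by
  rcases lt_or_gt_of_ne hne with hneg | hpos
  · have hpos' : 0 < r.neg.value := by
      rw [IntegralRep.value_neg]
      linarith
    obtain ⟨K, hKc, hKint, hKi, hK⟩ :=
      exists_isCompact_of_value_pos boundedReduction_one r.neg hr.neg hpos'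
    refine ⟨K, hKc, hKint, hKi, fun h => absurd hneg (lt_asymm h), fun _ => ?_⟩
    have : of r + of K = (of r + of r.neg) - (of r.neg - of K) := by abel
    rw [this]
    exact relations.sub_mem (levelRel_le_relations (of_add_of_neg_mem_levelRel r)) hK
  · obtain ⟨K, hKc, hKint, hKi, hK⟩ := exists_isCompact_of_value_pos boundedReduction_one r hr hpos
    exact ⟨K, hKc, hKint, hKi, fun _ => hK, fun h => absurd hpos (lt_asymm h)⟩


/-! ### The remaining input is separation of poles in dimension `≥ 2` only -/

/-- The bounded reduction holds trivially in dimension `0` (`ℝ⁰` is a point). [folklore] -/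
theorem boundedReduction_zero (r : IntegralRep 0) (_hr : r.IsRational)
    (hb : Bornology.IsBounded r.domain) :
    ∃ (k : ℕ) (R : Fin k → IntegralRep 0), (∀ j, Bornology.IsBounded (R j).domain ∧
      ∃ M : ℝ, ∀ x ∈ (R j).domain, |(R j).integrand x| ≤ M) ∧ of r - ∑ j, of (R j) ∈ relations :=
  ⟨1, fun _ => r, fun _ => ⟨hb, |r.integrand default|, fun x _ => by
    rw [Subsingleton.elim x default]⟩, by simp [relations.zero_mem]⟩

/-- **Thm. 1.1 in dimension `d` from the bounded reduction in dimension `d`** (the sign analysis of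
`KZ.semiCanonicalReduction_of_boundedReduction`, one dimension at a time): apply
`exists_isCompact_of_value_pos` to `r` if `r.value > 0` and to `r.neg` if `r.value < 0`.
[cite: ViuSos2021, Thm. 1.1] -/
theorem exists_of_boundedReduction_at {d : ℕ}
    (H : ∀ r : IntegralRep d, r.IsRational → Bornology.IsBounded r.domain →
      ∃ (k : ℕ) (R : Fin k → IntegralRep d), (∀ j, Bornology.IsBounded (R j).domain ∧
        ∃ M : ℝ, ∀ x ∈ (R j).domain, |(R j).integrand x| ≤ M) ∧ of r - ∑ j, of (R j) ∈ relations)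
    (r : IntegralRep d) (hr : r.IsRational) (hne : r.value ≠ 0) :
    ∃ (m : ℕ) (K : IntegralRep m), 0 < m ∧ m ≤ d + 1 ∧ IsCompact K.domain ∧
      (interior K.domain).Nonempty ∧ (∀ x ∈ K.domain, K.integrand x = 1) ∧
      (0 < r.value → of r - of K ∈ relations) ∧ (r.value < 0 → of r + of K ∈ relations) := by
  rcases lt_or_gt_of_ne hne with hneg | hpos
  · have hpos' : 0 < r.neg.value := by
      rw [IntegralRep.value_neg]
      linarith
    obtain ⟨K, hKc, hKint, hKi, hK⟩ := exists_isCompact_of_value_pos H r.neg hr.neg hpos'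
    refine ⟨d + 1, K, Nat.succ_pos d, le_rfl, hKc, hKint, hKi, fun h => absurd hneg (lt_asymm h),
      fun _ => ?_⟩
    have : of r + of K = (of r + of r.neg) - (of r.neg - of K) := by abel
    rw [this]
    exact relations.sub_mem (levelRel_le_relations (of_add_of_neg_mem_levelRel r)) hK
  · obtain ⟨K, hKc, hKint, hKi, hK⟩ := exists_isCompact_of_value_pos H r hr hpos
    exact ⟨d + 1, K, Nat.succ_pos d, le_rfl, hKc, hKint, hKi, fun _ => hK,
      fun h => absurd hpos (lt_asymm h)⟩

/-- **Viu-Sos' Thm. 1.1 from separation of poles in dimension `≥ 2` only.** After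
`boundedReduction_zero` and `boundedReduction_one`, the only unproved input of
`KZ.semiCanonicalReduction_of_boundedReduction` is its hypothesis in dimensions `n ≥ 2`: the
bounded reduction of integrable rational functions of at least two variables (Viu-Sos 2021,
Cor. 2.2 — for `n = 2` the explicit blow-up algorithm of §3, Thm. 3.1, whose termination
Lemma 3.2 is deduced from Prop. 2.2; for `n ≥ 3` Hironaka's embedded resolution, Thm. 2.2).
`H` is an explicit hypothesis and is NOT asserted here.
[cite: ViuSos2021, Thm. 1.1 (with Cor. 2.2 for d ≥ 2 as hypothesis)] -/
theorem semiCanonicalReduction_of_boundedReduction_two_le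
    (H : ∀ ⦃n : ℕ⦄, 2 ≤ n → ∀ r : IntegralRep n, r.IsRational → Bornology.IsBounded r.domain →
      ∃ (k : ℕ) (R : Fin k → IntegralRep n), (∀ j, Bornology.IsBounded (R j).domain ∧
        ∃ M : ℝ, ∀ x ∈ (R j).domain, |(R j).integrand x| ≤ M) ∧ of r - ∑ j, of (R j) ∈ relations) :
    semiCanonicalReduction := by
  intro d r hr hne
  rcases Nat.lt_or_ge d 2 with hd | hd
  · interval_cases d
    · exact exists_of_boundedReduction_at boundedReduction_zero r hr hne
    · exact exists_of_boundedReduction_at boundedReduction_one r hr hne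
  · exact exists_of_boundedReduction_at (H hd) r hr hne

end KZ

end Literature.NumberTheory.Transcendental
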